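import Literature.AnabelianGeometry.Anabelioids.FiniteEtaleLocalDictionaryStabilizer
import Literature.AnabelianGeometry.Anabelioids.TerminalCoproductComponents
import Literature.AnabelianGeometry.SemiGraphs.FiniteEtaleCoveringGlobalDef
import Literature.AnabelianGeometry.SemiGraphs.GraphOfAnabelioidsLimits
import Literature.AnabelianGeometry.SemiGraphs.GraphOfAnabelioidsGalois

/-!
# (D1) Decomposition groups along a finite étale covering — WITHOUT connectedness hypotheses

Mochizuki, *Semi-graphs of anabelioids*, Publ. RIMS **42** (2006), §2 p. 23 (Def. 2.2 (i): the finite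
étale covering `𝒢′ → 𝒢` attached to `A ∈ B(𝒢)` is DEFINED by `B(𝒢′) = B(𝒢)_{/A}`) and Remark 2.2.1 p. 24
("the image … is equal to the stabilizer") [cite: MochizukiSemiAnbd2006, Rem. 2.2.1 p.24]; for abstract
anabelioids *The geometry of anabelioids*, Publ. RIMS **40** (2004), Rem. 1.2.2.1 p. 17
[cite: MochizukiGeoAn2004, Rem. 1.2.2.1 p.17].

abc-iut cell, layer L3, row «D3b (CORE)» (abc-iut-w4-d071).  PROOF-ONLY file (no `def`).
abc-iut-L6-t17's abstract local dictionary (`FiniteEtaleLocalDictionary*.lean`: along `Q ≅ (S × −) ⋙ α`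
with `α : C_{/S} ⥲ D` an equivalence, `π₁(Q) : Aut F → Aut (Q ⋙ F)` is injective with image the
stabiliser of a base point) is stated for GALOIS categories `C`, `D` and a FIBRE FUNCTOR `F` of `D` valued
in the morphism universe; its proofs use of that only: binary products in `C`, `F` preserving pull-backs
and monomorphisms, and the one-point fibre of `F` at the terminal object `α(S = S)`.  Part A re-proves
the dictionary under exactly these hypotheses (`D` any category, `F : D ⥤ FintypeCat.{w}` any universe)
— the proofs are abc-iut-L6-t17's, verbatim.  Part B applies it to a morphism of semi-graphs of
anabelioids `φ : 𝒢′ → 𝒢` which is GLOBALLY the covering attached to `A` (abc-iut-L3-d3's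
`Hom.IsGlobalCoveringOf`: `φ^* ≅ (A × −) ⋙ α`, `α : B(𝒢)_{/A} ⥲ B(𝒢′)`), at `C := B(𝒢)`, `D := B(𝒢′)`,
`F := ρ′_{v′} ⋙ F′` (which preserves finite limits for EVERY `𝒢′` — limits in `B(𝒢′)` are componentwise,
`hasLimitsOfShape_bObj` — although it is a fibre functor only for connected `𝒢′`): the dictionary item
(D1) `covering_decompositionGroup` (abc-iut-L6-d4's `covering_decompositionGroup_of_isBObjCovering`)
holds WITHOUT the connectedness of `𝒢` and `𝒢′`, and without the universe switch.  Needed for the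
coverings of RESTRICTED semi-graphs `𝒢′|_{φ⁻¹ℍ} → 𝒢|_ℍ` ([SemiAnbd] p. 30, proof of Cor. 2.7 (i): "whose
restriction to `ℍ` we denote by `ℋ′ → ℍ`"), whose sources are disconnected in general.
Nothing here takes a side on [IUTchIII] Cor. 3.12.
-/

namespace Literature.AnabelianGeometry.Anabelioids

open CategoryTheory CategoryTheory.Limits CategoryTheory.Functor CategoryTheory.PreGaloisCategory

universe w u₁ u₂ u₃ u₄

/-! ### Part A. The abstract local dictionary under minimal hypotheses -/

section General

variable {C : Type u₁} [Category.{u₂} C] [HasBinaryProducts C] {D : Type u₃} [Category.{u₄} D] {S : C}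

/-- An automorphism of the basepoint `F` whose image under `π₁(Q)` is trivial acts trivially on every
fibre `F(α(S × A))` (any `α`, `F`). [cite: MochizukiGeoAn2004, Def. 1.2.2(i) p.17] -/
theorem app_star_eq_id_of_pi1Map_eq_one' (α : Over S ⥤ D) {Q : C ⥤ D} (e : Q ≅ Over.star S ⋙ α)
    (F : D ⥤ FintypeCat.{w}) (σ : Aut F) (hσ : pi1Map Q F σ = 1) (A : C) :
    σ.hom.app (α.obj ((Over.star S).obj A)) = 𝟙 _ := by
  have h1 : σ.hom.app (Q.obj A) = 𝟙 _ := by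
    have h := congrArg (fun τ : Aut (Q ⋙ F) => τ.hom.app A) hσ
    simp only [pi1Map_hom_app] at h
    exact h
  have hnat := σ.hom.naturality (e.hom.app A)
  rw [h1, Category.id_comp] at hnat
  exact (cancel_epi (F.map (e.hom.app A))).mp (hnat.trans (Category.comp_id _).symm)

/-- … hence trivially on every fibre `F(α(U → S))`, for `α` and `F` preserving monomorphisms
(`U ↪ S × U` over `S`). [cite: MochizukiGeoAn2004, Def. 1.2.2(i) p.17] -/
theorem app_over_eq_id_of_pi1Map_eq_one' (α : Over S ⥤ D) [α.PreservesMonomorphisms] {Q : C ⥤ D}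
    (e : Q ≅ Over.star S ⋙ α) (F : D ⥤ FintypeCat.{w}) [F.PreservesMonomorphisms] (σ : Aut F)
    (hσ : pi1Map Q F σ = 1) (U : Over S) : σ.hom.app (α.obj U) = 𝟙 _ := by
  let m : U ⟶ (Over.star S).obj U.left := (Over.forgetAdjStar S).unit.app U
  haveI : Mono m := mono_forgetAdjStar_unit U
  haveI : Mono (α.map m) := inferInstance
  haveI : Mono (F.map (α.map m)) := inferInstance
  have hnat := σ.hom.naturality (α.map m)
  rw [app_star_eq_id_of_pi1Map_eq_one' α e F σ hσ U.left, Category.comp_id] at hnat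
  exact (cancel_mono (F.map (α.map m))).mp (hnat.symm.trans (Category.id_comp _).symm)

/-- **Injectivity of `π₁(Q)`** along `Q ≅ (S × −) ⋙ α`, `α : C_{/S} ⥲ D` an equivalence, for ANY
basepoint `F` of `D` preserving monomorphisms. [cite: MochizukiGeoAn2004, Rem. 1.2.2.1 p.17] -/
theorem pi1Map_injective_of_star_comp' (α : Over S ⥤ D) [α.IsEquivalence] {Q : C ⥤ D}
    (e : Q ≅ Over.star S ⋙ α) (F : D ⥤ FintypeCat.{w}) [F.PreservesMonomorphisms] :
    Function.Injective (pi1Map Q F) := by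
  rw [injective_iff_map_eq_one]
  intro σ hσ
  refine Iso.ext (NatTrans.ext (funext fun Y => ?_))
  have hY : σ.hom.app ((α.asEquivalence.inverse ⋙ α.asEquivalence.functor).obj Y) = 𝟙 _ :=
    app_over_eq_id_of_pi1Map_eq_one' α e F σ hσ (α.inv.obj Y)
  have hnat := σ.hom.naturality (α.asEquivalence.counitIso.hom.app Y)
  rw [hY, Category.id_comp] at hnat
  have h2 : σ.hom.app ((𝟭 D).obj Y) = 𝟙 _ :=
    (cancel_epi (F.map (α.asEquivalence.counitIso.hom.app Y))).mp
      (hnat.trans (Category.comp_id _).symm)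
  exact h2

/-- `π₁(Q)(σ)` fixes the base point `s₀ = F(e⁻¹_S ∘ α(Δ))(t) ∈ F(Q S)` whenever the fibre `F(α(S = S))`
is a single point `t`. [cite: MochizukiSemiAnbd2006, Rem. 2.2.1 p.24] -/
theorem pi1Map_app_basePoint' (α : Over S ⥤ D) {Q : C ⥤ D} (e : Q ≅ Over.star S ⋙ α)
    (F : D ⥤ FintypeCat.{w}) [Subsingleton (F.obj (α.obj (Over.mk (𝟙 S))))] (σ : Aut F)
    (t : F.obj (α.obj (Over.mk (𝟙 S)))) :
    (pi1Map Q F σ).hom.app S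
        (F.map (α.map ((Over.forgetAdjStar S).unit.app (Over.mk (𝟙 S))) ≫ e.inv.app S) t) =
      F.map (α.map ((Over.forgetAdjStar S).unit.app (Over.mk (𝟙 S))) ≫ e.inv.app S) t := by
  rw [pi1Map_hom_app]
  exact app_map_eq_of_subsingleton F σ _ t

/-- **`range π₁(Q) ≤ Stab(s₀)`** for any basepoint `G ≅ Q ⋙ F` of `C` (isomorphism `β`), whenever the
fibre `F(α(S = S))` is a single point. [cite: MochizukiSemiAnbd2006, Rem. 2.2.1 p.24] -/
theorem range_pi1Map_le_stabilizer' (α : Over S ⥤ D) {Q : C ⥤ D} (e : Q ≅ Over.star S ⋙ α)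
    (F : D ⥤ FintypeCat.{w}) [Subsingleton (F.obj (α.obj (Over.mk (𝟙 S))))]
    {G : C ⥤ FintypeCat.{w}} (β : Q ⋙ F ≅ G) (t : F.obj (α.obj (Over.mk (𝟙 S)))) :
    ((Aut.autMulEquivOfIso β).toMonoidHom.comp (pi1Map Q F)).range ≤
      MulAction.stabilizer (Aut G) (β.hom.app S
        (F.map (α.map ((Over.forgetAdjStar S).unit.app (Over.mk (𝟙 S))) ≫ e.inv.app S) t)) := by
  rintro _ ⟨σ, rfl⟩
  rw [MulAction.mem_stabilizer_iff, mulAction_def]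
  show (β.inv ≫ (pi1Map Q F σ).hom ≫ β.hom).app S (β.hom.app S _) = _
  rw [NatTrans.comp_app, NatTrans.comp_app, FintypeCat.comp_apply, FintypeCat.comp_apply]
  have hb : β.inv.app S (β.hom.app S
      (F.map (α.map ((Over.forgetAdjStar S).unit.app (Over.mk (𝟙 S))) ≫ e.inv.app S) t)) =
      F.map (α.map ((Over.forgetAdjStar S).unit.app (Over.mk (𝟙 S))) ≫ e.inv.app S) t := by
    rw [← FintypeCat.comp_apply, Iso.hom_inv_id_app]
    rfl
  rw [hb, pi1Map_app_basePoint' α e F σ t]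

/-- **Lifting the stabiliser**, for `α : C_{/S} ⥲ D` an equivalence and ANY `F : D ⥤ FintypeCat`
preserving pull-backs and monomorphisms with one-point fibre at `α(S = S)`: every automorphism `τ` of
`Q ⋙ F` fixing the base point is `π₁(Q)(σ)` for some `σ ∈ Aut F` (abc-iut-L6-t17's proof).
[cite: MochizukiSemiAnbd2006, Rem. 2.2.1 p.24] -/
theorem exists_aut_pi1Map_eq_of_app_basePoint' (α : Over S ⥤ D) [α.IsEquivalence] {Q : C ⥤ D}
    (e : Q ≅ Over.star S ⋙ α) (F : D ⥤ FintypeCat.{w}) [PreservesLimitsOfShape WalkingCospan F]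
    [F.PreservesMonomorphisms] [Subsingleton (F.obj (α.obj (Over.mk (𝟙 S))))]
    (t : F.obj (α.obj (Over.mk (𝟙 S)))) (τ : Aut (Q ⋙ F))
    (hτ : τ.hom.app S
        (F.map (α.map ((Over.forgetAdjStar S).unit.app (Over.mk (𝟙 S))) ≫ e.inv.app S) t) =
      F.map (α.map ((Over.forgetAdjStar S).unit.app (Over.mk (𝟙 S))) ≫ e.inv.app S) t) :
    ∃ σ : Aut F, pi1Map Q F σ = τ := by
  haveI : Subsingleton ((α ⋙ F).obj (Over.mk (𝟙 S))) :=
    ‹Subsingleton (F.obj (α.obj (Over.mk (𝟙 S))))›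
  -- transport `τ` along `e` to an automorphism of `(S × −) ⋙ (α ⋙ F)`
  let τ₁ : (Over.star S ⋙ α) ⋙ F ≅ (Over.star S ⋙ α) ⋙ F :=
    (isoWhiskerRight e F).symm ≪≫ τ ≪≫ isoWhiskerRight e F
  have hτ₁_app : ∀ (A : C), τ₁.hom.app A =
      F.map (e.inv.app A) ≫ τ.hom.app A ≫ F.map (e.hom.app A) := fun A => rfl
  have hm : ∀ y : F.obj ((Over.star S ⋙ α).obj S),
      F.map (e.hom.app S) (F.map (e.inv.app S) y) = y := fun y =>
    ConcreteCategory.congr_hom (F.mapIso (e.app S)).inv_hom_id y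
  have h2 : F.map (e.inv.app S) (F.map (α.map ((Over.forgetAdjStar S).unit.app (Over.mk (𝟙 S)))) t) =
      F.map (α.map ((Over.forgetAdjStar S).unit.app (Over.mk (𝟙 S))) ≫ e.inv.app S) t :=
    (ConcreteCategory.congr_hom (F.map_comp _ _) t).symm
  have hτ₁ : τ₁.hom.app S ((α ⋙ F).map ((Over.forgetAdjStar S).unit.app (Over.mk (𝟙 S))) t) =
      (α ⋙ F).map ((Over.forgetAdjStar S).unit.app (Over.mk (𝟙 S))) t := by
    show F.map (e.hom.app S) (τ.hom.app S (F.map (e.inv.app S)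
      (F.map (α.map ((Over.forgetAdjStar S).unit.app (Over.mk (𝟙 S)))) t))) =
      F.map (α.map ((Over.forgetAdjStar S).unit.app (Over.mk (𝟙 S)))) t
    rw [h2, hτ, ← h2]
    exact hm _
  -- part 2 (abc-iut-L6-t17): lift on `C_{/S}`
  obtain ⟨σ₁, hσ₁⟩ := exists_aut_pi1Map_star_eq (α ⋙ F) t τ₁ hτ₁
  -- move along the equivalence `α`
  obtain ⟨σ, hσ⟩ := pi1Map_surjective_of_isEquivalence α F σ₁
  refine ⟨σ, Iso.ext (NatTrans.ext (funext fun A => ?_))⟩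
  have h1 : σ.hom.app ((Over.star S ⋙ α).obj A) =
      F.map (e.inv.app A) ≫ τ.hom.app A ≫ F.map (e.hom.app A) := by
    have h := congrArg (fun ρ : Aut (Over.star S ⋙ α ⋙ F) => ρ.hom.app A) hσ₁
    rw [← hσ] at h
    simp only [pi1Map_hom_app] at h
    exact h.trans (hτ₁_app A)
  have hnat := σ.hom.naturality (e.hom.app A)
  rw [h1, ← Category.assoc, ← F.map_comp, Iso.hom_inv_id_app, F.map_id] at hnat
  erw [Category.id_comp] at hnat
  rw [pi1Map_hom_app]
  exact ((cancel_mono (F.map (e.hom.app A))).mp hnat.symm)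

/-- **Range `π₁(Q)` = stabiliser of the base point**, for `α : C_{/S} ⥲ D` an equivalence,
`Q ≅ (S × −) ⋙ α`, ANY `F : D ⥤ FintypeCat` preserving pull-backs and monomorphisms with one-point
fibre at `α(S = S)`, and any basepoint `G ≅ Q ⋙ F` of `C` (isomorphism `β`): the image of
`Aut F → Aut (Q ⋙ F) ⥲ Aut G` is the stabiliser in `Aut G` of `β(s₀) ∈ G(S)`.
[cite: MochizukiSemiAnbd2006, Rem. 2.2.1 p.24] -/
theorem range_pi1Map_eq_stabilizer' (α : Over S ⥤ D) [α.IsEquivalence] {Q : C ⥤ D}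
    (e : Q ≅ Over.star S ⋙ α) (F : D ⥤ FintypeCat.{w}) [PreservesLimitsOfShape WalkingCospan F]
    [F.PreservesMonomorphisms] [Subsingleton (F.obj (α.obj (Over.mk (𝟙 S))))]
    {G : C ⥤ FintypeCat.{w}} (β : Q ⋙ F ≅ G) (t : F.obj (α.obj (Over.mk (𝟙 S)))) :
    ((Aut.autMulEquivOfIso β).toMonoidHom.comp (pi1Map Q F)).range =
      MulAction.stabilizer (Aut G) (β.hom.app S
        (F.map (α.map ((Over.forgetAdjStar S).unit.app (Over.mk (𝟙 S))) ≫ e.inv.app S) t)) := by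
  refine le_antisymm (range_pi1Map_le_stabilizer' α e F β t) ?_
  intro ρ hρ
  rw [MulAction.mem_stabilizer_iff, mulAction_def] at hρ
  let τ : Aut (Q ⋙ F) := (Aut.autMulEquivOfIso β).symm ρ
  have hτρ : (Aut.autMulEquivOfIso β) τ = ρ := (Aut.autMulEquivOfIso β).apply_symm_apply ρ
  have hτ_app : τ.hom.app S = β.hom.app S ≫ ρ.hom.app S ≫ β.inv.app S := rfl
  have hτ : τ.hom.app S
      (F.map (α.map ((Over.forgetAdjStar S).unit.app (Over.mk (𝟙 S))) ≫ e.inv.app S) t) =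
      F.map (α.map ((Over.forgetAdjStar S).unit.app (Over.mk (𝟙 S))) ≫ e.inv.app S) t := by
    rw [hτ_app, FintypeCat.comp_apply, FintypeCat.comp_apply, hρ, ← FintypeCat.comp_apply,
      Iso.hom_inv_id_app]
    rfl
  obtain ⟨σ, hσ⟩ := exists_aut_pi1Map_eq_of_app_basePoint' α e F t τ hτ
  exact ⟨σ, by simp [hσ, hτρ]⟩

end General

end Literature.AnabelianGeometry.Anabelioids

/-! ### Part B. (D1) for `φ : 𝒢′ → 𝒢` globally the covering attached to `A`, no connectedness -/

namespace Literature.AnabelianGeometry.SemiGraphs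

open CategoryTheory CategoryTheory.Limits CategoryTheory.PreGaloisCategory
open Literature.AnabelianGeometry.Anabelioids

universe v₁ u₁ u

namespace SemiGraphOfAnabelioids

variable {𝒢 𝒢' : SemiGraphOfAnabelioids.{v₁, u₁, u}}

/-- The restriction functors `ρ_v : B(𝒢) ⥤ 𝒢_v` preserve pull-backs, for EVERY semi-graph of
anabelioids (limits in `B(𝒢)` are componentwise). [cite: MochizukiSemiAnbd2006, Def. 2.1 p.23] -/
theorem preservesPullbacks_ρ (𝒢 : SemiGraphOfAnabelioids.{v₁, u₁, u}) (v : 𝒢.graph.Vertex) :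
    PreservesLimitsOfShape WalkingCospan (𝒢.ρ v) := by
  haveI : ∀ (b : 𝒢.graph.Branch) (v : 𝒢.graph.Vertex) (h : 𝒢.graph.abuts b = some v),
      PreservesLimitsOfShape WalkingCospan (𝒢.pull b v h).pullback := fun b v h => by
    haveI : PreservesFiniteLimits (𝒢.pull b v h).pullback := (𝒢.pull b v h).property.1
    infer_instance
  exact (𝒢.hasLimitsOfShape_bObj (J := WalkingCospan)).2.1 v

/-- The restriction functors `ρ_v : B(𝒢) ⥤ 𝒢_v` preserve terminal objects, for EVERY semi-graph of
anabelioids. [cite: MochizukiSemiAnbd2006, Def. 2.1 p.23] -/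
theorem preservesTerminal_ρ (𝒢 : SemiGraphOfAnabelioids.{v₁, u₁, u}) (v : 𝒢.graph.Vertex) :
    PreservesLimitsOfShape (Discrete PEmpty.{1}) (𝒢.ρ v) := by
  haveI : ∀ (b : 𝒢.graph.Branch) (v : 𝒢.graph.Vertex) (h : 𝒢.graph.abuts b = some v),
      PreservesLimitsOfShape (Discrete PEmpty.{1}) (𝒢.pull b v h).pullback := fun b v h => by
    haveI : PreservesFiniteLimits (𝒢.pull b v h).pullback := (𝒢.pull b v h).property.1
    infer_instance
  exact (𝒢.hasLimitsOfShape_bObj (J := Discrete PEmpty.{1})).2.1 v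

/-- **(D1) without connectedness.**  For ANY semi-graphs of anabelioids `𝒢`, `𝒢′`, a morphism
`φ : 𝒢′ → 𝒢` which is GLOBALLY the covering attached to `A ∈ B(𝒢)` (`Hom.IsGlobalCoveringOf`:
`φ^* ≅ (A × −) ⋙ α` for an equivalence `α : B(𝒢)_{/A} ⥲ B(𝒢′)`), a vertex `v′` of `𝒢′` with basepoint
`F′` of `𝒢′_{v′}`, any functor `F` on `𝒢_v` (`v = φ v′`) and `e : φ_{v′}^* ⋙ F′ ≅ F`: the homomorphism
`ι = Aut(ρ_v ⋙ e) ∘ π₁(φ^*) : Π_{𝒢′} = Aut(ρ′_{v′} ⋙ F′) → Π_𝒢 = Aut(ρ_v ⋙ F)` is injective with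
image the stabiliser of a point of the fibre `F(A_v)` — [SemiAnbd] Rem. 2.2.1, in the shape of the
dictionary item (D1) `covering_decompositionGroup` but with NO connectedness of `𝒢`, `𝒢′` (so that it
applies to restricted coverings `𝒢′|_{φ⁻¹ℍ} → 𝒢|_ℍ`).  Part A at `C := B(𝒢)`, `D := B(𝒢′)`,
`F := ρ′_{v′} ⋙ F′`. [cite: MochizukiSemiAnbd2006, Rem. 2.2.1 p.24] -/
theorem covering_decompositionGroup_of_isGlobalCoveringOf (φ : Hom 𝒢' 𝒢) (A : 𝒢.BObj)
    (hB : φ.IsGlobalCoveringOf A)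
    (v' : 𝒢'.graph.Vertex) (F' : 𝒢'.V v' ⥤ FintypeCat.{v₁}) [FiberFunctor F']
    (F : 𝒢.V (φ.base.vertexMap v') ⥤ FintypeCat.{v₁})
    (e : (φ.φV v').pullback ⋙ F' ≅ F) :
    ∃ x₀ : (𝒢.ρ (φ.base.vertexMap v') ⋙ F).obj A,
      Function.Injective
          ((Aut.autMulEquivOfIso (Functor.isoWhiskerLeft (𝒢.ρ (φ.base.vertexMap v')) e)
              ).toMonoidHom.comp (pi1Map φ.pullbackFunctor (𝒢'.ρ v' ⋙ F'))) ∧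
        ((Aut.autMulEquivOfIso (Functor.isoWhiskerLeft (𝒢.ρ (φ.base.vertexMap v')) e)
              ).toMonoidHom.comp (pi1Map φ.pullbackFunctor (𝒢'.ρ v' ⋙ F'))).range =
          MulAction.stabilizer (𝒢.Pi (φ.base.vertexMap v') F) x₀ := by
  obtain ⟨hprod, α, hα, ⟨eB⟩⟩ := hB
  haveI := hprod
  haveI := hα
  -- notation: `Q = φ^*`, the basepoints `K′ = ρ′_{v′} ⋙ F′` of `B(𝒢′)` and `K = ρ_v ⋙ F` of `B(𝒢)`
  let Q : 𝒢.BObj ⥤ 𝒢'.BObj := φ.pullbackFunctor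
  let K' : 𝒢'.BObj ⥤ FintypeCat.{v₁} := 𝒢'.ρ v' ⋙ F'
  let K : 𝒢.BObj ⥤ FintypeCat.{v₁} := 𝒢.ρ (φ.base.vertexMap v') ⋙ F
  let eK : Q ⋙ K' ≅ K := Functor.isoWhiskerLeft (𝒢.ρ (φ.base.vertexMap v')) e
  let ι : Aut K' →* Aut K := (Aut.autMulEquivOfIso eK).toMonoidHom.comp (pi1Map Q K')
  change ∃ x₀ : K.obj A, Function.Injective ι ∧ ι.range = MulAction.stabilizer (Aut K) x₀
  -- `K′` preserves pull-backs and monomorphisms, with one-point fibre at the terminal `α(A = A)`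
  haveI : PreservesLimitsOfShape WalkingCospan (𝒢'.ρ v') := preservesPullbacks_ρ 𝒢' v'
  haveI : PreservesLimitsOfShape (Discrete PEmpty.{1}) (𝒢'.ρ v') := preservesTerminal_ρ 𝒢' v'
  haveI : PreservesLimitsOfShape WalkingCospan K' := inferInstance
  haveI : K'.PreservesMonomorphisms := inferInstance
  have hT : IsTerminal (α.obj (Over.mk (𝟙 A))) := Over.mkIdTerminal.isTerminalObj α _
  have hT' : IsTerminal ((𝒢'.ρ v').obj (α.obj (Over.mk (𝟙 A)))) := hT.isTerminalObj (𝒢'.ρ v') _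
  let i : (𝒢'.ρ v').obj (α.obj (Over.mk (𝟙 A))) ≅ ⊤_ (𝒢'.V v') := hT'.uniqueUpToIso terminalIsTerminal
  obtain ⟨eT⟩ := nonempty_equiv_fiber_terminal_punit F'
  haveI : Subsingleton (K'.obj (α.obj (Over.mk (𝟙 A)))) :=
    ((FintypeCat.equivEquivIso.symm (F'.mapIso i)).trans eT).subsingleton
  let t : K'.obj (α.obj (Over.mk (𝟙 A))) := (FintypeCat.equivEquivIso.symm (F'.mapIso i)).symm
    (eT.symm PUnit.unit)
  refine ⟨eK.hom.app A (K'.map (α.map ((Over.forgetAdjStar A).unit.app (Over.mk (𝟙 A))) ≫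
      eB.inv.app A) t), ?_, ?_⟩
  · exact (Aut.autMulEquivOfIso eK).injective.comp (pi1Map_injective_of_star_comp' α eB K')
  · exact range_pi1Map_eq_stabilizer' α eB K' eK t

end SemiGraphOfAnabelioids

end Literature.AnabelianGeometry.SemiGraphs
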